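import Summits.QuantumAdvantage.QuantumAdvantage.Theses.XorDarkCharacters
import Summits.QuantumAdvantage.QuantumAdvantage.Theses.Dequantize

/-!
# RedirectCensus — kernel companion of `STRATEGY-CENSUS.md` (cstrat r1, stmt-QuantumAdvantage-9867 `XorCharFlat`)

Checked facts used by the census:

* `xdcThesis_iff_not_quantumAdvantage` — the route's only load-bearing binder `XdcThesis`
  (`BQP ⊆ BPP`, item stmt-QuantumAdvantage-0242) is the NEGATED SUMMIT verbatim (the costume theorem).
* `closes_thesis_only` / `assembly_holds` — the deciding theorem needs no other item; in particular
  `XorCharFlat` is idle (gate cone: `binder_used = [XdcThesis]`).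
* `MidbandXorCharFlat` + `xorCharFlat_of_offband_of_midband` + `xorCharFlat_iff_offband_and_midband`
  — the honest ARITHMETIC split of the crux along the Hamming weight of the shift
  (`OffbandXorCharFlat` is already item stmt-QuantumAdvantage-9868); typed and proved here for the
  bank, NOT filed as a route split (neither piece is in the cone of `S` or `¬S`; see the census).
-/

set_option linter.dupNamespace false -- D-0017: single-problem summit ⇒ `QuantumAdvantage.QuantumAdvantage` by design

namespace Summit.QuantumAdvantage.QuantumAdvantage.Cruxes.XorCharFlat.RedirectCensus

open Summit.QuantumAdvantage.QuantumAdvantage.Theses.XorDarkCharacters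

/-! ## 0. The deciding binder is the shared ¬S-side thesis (item stmt-QuantumAdvantage-0242) -/

/-- `XdcThesis` is token for token `Dequantize.DeqThesis` (and `SymplecticPurity.FFThesis`,
`PauliFlat.PPThesis`, …: one ledger item, stmt-QuantumAdvantage-0242, wanted by 8 routes). The standing
disprover's workfile `Cruxes/DeqThesis/Disproof.lean` §1 records `not_ffThesis_iff_quantumAdvantage`
("a kill of this crux is the summit itself"); §1 below is the same fact for this route's decl. -/
theorem xdcThesis_iff_deqThesis :
    XdcThesis ↔ Summit.QuantumAdvantage.QuantumAdvantage.Theses.Dequantize.DeqThesis := Iff.rfl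

/-! ## 1. The deciding binder is `¬ S` in costume -/

/-- `XdcThesis ↔ ¬ QuantumAdvantage`: `BQP ⊆ BPP` is (classically) the negation of
`∃ L, L ∈ BQP ∧ L ∉ BPP`. -/
theorem xdcThesis_iff_not_quantumAdvantage : XdcThesis ↔ ¬ _root_.QuantumAdvantage := by
  constructor
  · rintro h ⟨L, hL, hnL⟩
    exact hnL (h hL)
  · intro hns L hL
    by_contra hLn
    exact hns ⟨L, hL, hLn⟩

/-- The deciding theorem with every binder except the thesis deleted. -/
theorem closes_thesis_only (h : XdcThesis) : ¬ _root_.QuantumAdvantage :=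
  xdcThesis_iff_not_quantumAdvantage.1 h

/-- Item stmt-QuantumAdvantage-9874 `Assembly := XdcThesis → ¬ QuantumAdvantage` holds outright. -/
theorem assembly_holds : Assembly := closes_thesis_only

/-- The route's `closes` factors through the thesis alone (definitional restatement of idleness:
the eight other binders are discarded). -/
theorem closes_eq_thesis_only :
    ∀ (h0 : XdcThesis) (h1 : XorCharFlat) (h2 : OffbandXorCharFlat) (h3 : CharWalshFlat)
      (h4 : CharStateFlat) (h5 : ZSectorRange) (h6 : ResonantCells) (h7 : FlatOfXorFlat) (h8 : Assembly),
      closes h0 h1 h2 h3 h4 h5 h6 h7 h8 = closes_thesis_only h0 :=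
  fun _ _ _ _ _ _ _ _ _ => rfl

/-! ## 2. The honest arithmetic split of the crux (banked, not filed) -/

/-- MID-BAND piece: some band `|popcount a − n/2| < η n` on which the Walsh-twisted XOR-autocorrelation
of `χ` (resonant cells removed) saves a power. This is the whole difficulty of `XorCharFlat`
(square-root barrier: a bilinear multiplicative-character sum over two complementary binary cubes of
size `≈ √p`). -/
def MidbandXorCharFlat : Prop :=
  ∃ η : ℝ, 0 < η ∧ ∃ δ : ℝ, 0 < δ ∧ ∃ p₀ : ℕ, ∀ p : ℕ, p₀ ≤ p → p.Prime → ∀ n : ℕ, 2 ^ (n - 1) < p → p < 2 ^ n → ∀ χ : MulChar (ZMod p) ℂ, χ ≠ 1 → ∀ a b : ℕ, 0 < a → a < 2 ^ n → b < 2 ^ n → ((1 / 2 - η) * n < (((Finset.range n).filter fun i => a.testBit i).card : ℝ) ∧ (((Finset.range n).filter fun i => a.testBit i).card : ℝ) < (1 / 2 + η) * n) → ‖∑ x ∈ Finset.range p, (if x ^^^ a < p ∧ (x + (x ^^^ a)) % p ≠ 0 then χ (x : ZMod p) * starRingEnd ℂ (χ ((x ^^^ a : ℕ) : ZMod p)) *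 (∏ i ∈ Finset.range n, (if b.testBit i ∧ x.testBit i then (-1 : ℂ) else 1)) else 0)‖ ≤ (p : ℝ) ^ ((1 : ℝ) - δ)

/-- ASSEMBLY of the split: off-band (item 9868) and mid-band give the crux (item 9867). -/
theorem xorCharFlat_of_offband_of_midband (hoff : OffbandXorCharFlat) (hmid : MidbandXorCharFlat) :
    XorCharFlat := by
  obtain ⟨η, hη, δ₂, hδ₂, p₂, h₂⟩ := hmid
  obtain ⟨δ₁, hδ₁, p₁, h₁⟩ := hoff η hη
  refine ⟨min δ₁ δ₂, lt_min hδ₁ hδ₂, max p₁ p₂, ?_⟩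
  intro p hp hprime n hn1 hn2 χ hχ a b ha han hbn
  have hp1 : p₁ ≤ p := le_trans (le_max_left _ _) hp
  have hp2 : p₂ ≤ p := le_trans (le_max_right _ _) hp
  have hpos : (1 : ℝ) ≤ (p : ℝ) := by exact_mod_cast hprime.one_lt.le
  by_cases hcase :
      ((((Finset.range n).filter fun i => a.testBit i).card : ℝ) ≤ (1 / 2 - η) * n ∨
        (1 / 2 + η) * n ≤ (((Finset.range n).filter fun i => a.testBit i).card : ℝ))
  · have hb := h₁ p hp1 hprime n hn1 hn2 χ hχ a b ha han hbn hcase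
    refine hb.trans ?_
    apply Real.rpow_le_rpow_of_exponent_le hpos
    linarith [min_le_left δ₁ δ₂]
  · have hband : (1 / 2 - η) * n < (((Finset.range n).filter fun i => a.testBit i).card : ℝ) ∧
        (((Finset.range n).filter fun i => a.testBit i).card : ℝ) < (1 / 2 + η) * n := by
      push Not at hcase
      exact ⟨hcase.1, hcase.2⟩
    have hb := h₂ p hp2 hprime n hn1 hn2 χ hχ a b ha han hbn hband
    refine hb.trans ?_
    apply Real.rpow_le_rpow_of_exponent_le hpos
    linarith [min_le_right δ₁ δ₂]

/-- The crux gives the mid-band piece back (take any `η`, e.g. `η = 1`, and the crux's `δ`). -/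
theorem midband_of_xorCharFlat (h : XorCharFlat) : MidbandXorCharFlat := by
  obtain ⟨δ, hδ, p₀, h⟩ := h
  exact ⟨1, one_pos, δ, hδ, p₀, fun p hp hprime n hn1 hn2 χ hχ a b ha han hbn _ =>
    h p hp hprime n hn1 hn2 χ hχ a b ha han hbn⟩

/-- … and the off-band piece (ignore the weight hypothesis). -/
theorem offband_of_xorCharFlat (h : XorCharFlat) : OffbandXorCharFlat := by
  obtain ⟨δ, hδ, p₀, h⟩ := h
  exact fun η _ => ⟨δ, hδ, p₀, fun p hp hprime n hn1 hn2 χ hχ a b ha han hbn _ =>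
    h p hp hprime n hn1 hn2 χ hχ a b ha han hbn⟩

/-- Exactness of the split. Both pieces are CONSEQUENCES of the crux (so each is strictly on the
crux's side of the summit: none of them implies `S` or `¬ S`, cf. the probe files). -/
theorem xorCharFlat_iff_offband_and_midband :
    XorCharFlat ↔ (OffbandXorCharFlat ∧ MidbandXorCharFlat) :=
  ⟨fun h => ⟨offband_of_xorCharFlat h, midband_of_xorCharFlat h⟩,
   fun h => xorCharFlat_of_offband_of_midband h.1 h.2⟩

end Summit.QuantumAdvantage.QuantumAdvantage.Cruxes.XorCharFlat.RedirectCensus
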